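import Literature.Computability.Cryptography.UOWHFChainComposeSecurity
import HarnessLib

/-!
# Tree hashing of a leveled halving family (Goldreich 2004, Constructions 6.4.24 and 6.4.26): the construction

Topic `Literature/Computability/Cryptography`. Steps III and IV of Goldreich's route from a restricted, halving UOWHF to
a full-fledged UOWHF (Def. 6.4.18): Step III (Construction 6.4.24) applies ONE function of a `(2m, m)`-family blockwise
to inputs of any length (a "quasi-UOWHF" halving its input), Step IV (Construction 6.4.26) composes such blockwise maps
level by level with a fresh key per level — together: Merkle/Naor–Yung tree hashing with per-level keys. We run it
over a `p`-shaped leveled halving family (`pShaped P hb`, at level `n`: `g_s : {0,1}^{2m(n)} → {0,1}^{m(n)}`, as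
produced by `HHRVW.compose2`), at a FIXED level `n`:

* pad `x ↦ x 1 0^k` to length `m·2^t`, `t = depth m |x|` least with `|x| + 1 ≤ m·2^t` (`padStr`, injective);
* levels `z₀ = pad x`, `z_{i+1} = (g_{s_{i+1}} applied to the 2m-bit blocks of z_i)` (`blockwise`, `level`), `t` levels;
* output `⟨t⟩_{aL} ++ z_t` of the fixed length `aL(n) + m(n)` (`aL = |bin L| + 1`; the depth in the output separates the
  depths), and the all-zero junk of that length when `t > L(n)` — inputs longer than `m·2^{L(n)}`, which no
  polynomial-time adversary produces for large `n` (`treeOut`).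

The new index at level `n` is `1ⁿ 0 (r_1 ++ ⋯ ++ r_L ++ padding)` on `pT(n) ≥ L(n)·P(n)` coins (again `p`-shaped). This file:
the specification `TSpec`/`TSpec.WF`, the string semantics with its structural lemmas (`depth` and its minimality,
`length_padStr`, `padStr_injective`, `length_level`, `treeOut` length and the decoding of the depth,
`treeOut_eq_treeOut` — equal outputs of in-range inputs have equal depth and equal top level), and the collection
`treeHash S` as a `HashCollection` given an evaluation brick (the FP evaluator is the next file). All proved; no named facts.

## References

* O. Goldreich, *Foundations of Cryptography II*, CUP 2004, §6.4.3.2, Constructions 6.4.24, 6.4.26, Props. 6.4.25, 6.4.27.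
* M. Naor, M. Yung, *Universal one-way hash functions and their cryptographic applications*, STOC 1989, §2.
* R. Merkle, *A certified digital signature*, CRYPTO 1989 (tree hashing).
-/

namespace Literature.Computability.Cryptography

namespace TreeHash

open _root_.Computability Complexity Complexity.Brick Complexity.Plumb Complexity.BitCodec Polynomial
open HHRVW (fitLen length_fitLen fitLen_of_length_eq)
open MDCompose (pShaped pShaped_index_run pShaped_hash nOf_length_idx length_index_pShaped)

/-! ### The specification -/

/-- The data of a tree hashing: the halving brick `hb` on `⟨s, x⟩` (`s = 1ⁿ0r`, `|r| = P n`; `{0,1}^{2m} → {0,1}^m` at level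
`n`), its coin polynomial `P`, the half-block length `m`, the number of levels `L`, unary bricks for `m` and `L`, polynomial
bounds `Pm ≥ m`, `PL ≥ L`, and the coin polynomial `pT ≥ L·P` of the tree index. [cite: Goldreich2004, Construction 6.4.26] -/
structure TSpec where
  /-- The halving brick on `⟨s, x⟩`. -/
  hb : List Bool → List Bool
  /-- Coins of the basic index. -/
  P : Polynomial ℕ
  /-- Half-block length at level `n`. -/
  m : ℕ → ℕ
  /-- Number of tree levels (keys) at level `n`. -/
  L : ℕ → ℕ
  /-- Unary brick for `m`. -/
  mF : List Bool → List Bool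
  /-- Unary brick for `L`. -/
  LF : List Bool → List Bool
  /-- Polynomial bound on `m`. -/
  Pm : Polynomial ℕ
  /-- Polynomial bound on `L`. -/
  PL : Polynomial ℕ
  /-- Coins of the tree index. -/
  pT : Polynomial ℕ

/-- Well-formedness of a tree specification. [cite: Goldreich2004, Construction 6.4.26 ("tedious details")] -/
structure TSpec.WF (S : TSpec) : Prop where
  hb_mem : S.hb ∈ FP
  mF_apply : ∀ n, S.mF (ones n) = ones (S.m n)
  LF_apply : ∀ n, S.LF (ones n) = ones (S.L n)
  mF_mem : S.mF ∈ FP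
  LF_mem : S.LF ∈ FP
  m_le : ∀ n, S.m n ≤ S.Pm.eval n
  L_le : ∀ n, S.L n ≤ S.PL.eval n
  pT_ge : ∀ n, S.L n * S.P.eval n ≤ S.pT.eval n
  one_le_m : ∀ n, 1 ≤ S.m n
  length_hb : ∀ (n : ℕ) (r x : List Bool), r.length = S.P.eval n → x.length = 2 * S.m n →
    (S.hb (boolPair (ones n ++ false :: r) x)).length = S.m n

variable (S : TSpec)

/-- The basic (halving) collection of a specification. [cite: Goldreich2004, Def. 6.4.19] -/
def base : HashCollection := pShaped S.P S.hb

/-! ### Depth and padding -/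

section Pad

/-- A half-block of `m ≥ 1` bits eventually accommodates any length. [folklore] -/
theorem exists_depth {m : ℕ} (hm : 1 ≤ m) (ℓ : ℕ) : ∃ t, ℓ + 1 ≤ m * 2 ^ t :=
  ⟨ℓ + 1, le_trans (Nat.lt_two_pow_self).le (by nlinarith [Nat.one_le_two_pow (n := ℓ + 1)])⟩

/-- **The depth** of an input of length `ℓ`: the least `t` with `ℓ + 1 ≤ m·2^t` (junk `0` for `m = 0`).
[cite: Goldreich2004, Construction 6.4.26 (`t` with `x ∈ {0,1}^{2^t·n}` after padding)] -/
noncomputable def depth (m ℓ : ℕ) : ℕ := if hm : 1 ≤ m then Nat.find (exists_depth hm ℓ) else 0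

/-- The depth accommodates the input. [folklore] -/
theorem le_pow_depth {m : ℕ} (hm : 1 ≤ m) (ℓ : ℕ) : ℓ + 1 ≤ m * 2 ^ depth m ℓ := by
  rw [depth, dif_pos hm]; exact Nat.find_spec (exists_depth hm ℓ)

/-- The depth is least. [folklore] -/
theorem depth_le_of_le {m : ℕ} (hm : 1 ≤ m) {ℓ t : ℕ} (h : ℓ + 1 ≤ m * 2 ^ t) : depth m ℓ ≤ t := by
  rw [depth, dif_pos hm]; exact Nat.find_min' _ h

/-- Smaller depths do not accommodate the input. [folklore] -/
theorem lt_of_lt_depth {m : ℕ} (hm : 1 ≤ m) {ℓ t : ℕ} (h : t < depth m ℓ) : m * 2 ^ t < ℓ + 1 := by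
  by_contra hc; push Not at hc; exact absurd (depth_le_of_le hm hc) (not_le.2 h)

/-- The padded length is less than twice the input length plus `2m`. [folklore] -/
theorem pow_depth_le {m : ℕ} (hm : 1 ≤ m) (ℓ : ℕ) : m * 2 ^ depth m ℓ ≤ 2 * ℓ + 2 * m := by
  rcases Nat.eq_zero_or_pos (depth m ℓ) with h | h
  · rw [h, pow_zero, mul_one]; omega
  · have := lt_of_lt_depth hm (ℓ := ℓ) (t := depth m ℓ - 1) (by omega)
    have e : m * 2 ^ depth m ℓ = 2 * (m * 2 ^ (depth m ℓ - 1)) := by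
      rw [← Nat.succ_pred_eq_of_pos h, pow_succ]; simp; ring
    omega

/-- The depth of a polynomially long input is at most its length plus one... precisely `depth ≤ ℓ + 1`. [folklore] -/
theorem depth_le_succ {m : ℕ} (hm : 1 ≤ m) (ℓ : ℕ) : depth m ℓ ≤ ℓ + 1 :=
  depth_le_of_le hm (le_trans (Nat.lt_two_pow_self).le (by nlinarith [Nat.one_le_two_pow (n := ℓ + 1)]))

/-- **The padding** `x ↦ x 1 0^k` to length `m·2^{depth}`. [cite: Goldreich2004, Construction 6.4.24 (`x_t 1 0^{d−|x_t|−1}`) and 6.4.26] -/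
noncomputable def padStr (m : ℕ) (x : List Bool) : List Bool := x ++ true :: List.replicate (m * 2 ^ depth m x.length - x.length - 1) false

/-- Length of the padding. [folklore] -/
theorem length_padStr {m : ℕ} (hm : 1 ≤ m) (x : List Bool) : (padStr m x).length = m * 2 ^ depth m x.length := by
  have := le_pow_depth hm x.length
  simp only [padStr, List.length_append, List.length_cons, List.length_replicate]; omega

/-- The padding is the `1 0*`-padding of `OneWayFunctionsLengthPreserving.lean`. [folklore] -/
theorem padStr_eq_pad (m : ℕ) (x : List Bool) : padStr m x = LenPres.pad (m * 2 ^ depth m x.length - 1) x := by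
  rw [padStr, LenPres.pad]
  congr 3
  omega

/-- Unpadding recovers the input: the padding is injective. [folklore] -/
theorem unpad_padStr (m : ℕ) (x : List Bool) : LenPres.unpad (padStr m x) = x := by
  rw [padStr_eq_pad, LenPres.unpad_pad]

/-- **The padding is injective.** [cite: Goldreich2004, Construction 6.4.26 ("padded … in a standard manner")] -/
theorem padStr_injective (m : ℕ) : Function.Injective (padStr m) := fun x y h => by
  rw [← unpad_padStr m x, h, unpad_padStr]

end Pad

/-! ### The tree at one level: string semantics -/

section Tree

variable (n : ℕ) (kb : List Bool)

/-- Key `i` of the tree index coins: the `i`-th block of `P(n)` coins. [cite: Goldreich2004, Construction 6.4.26] -/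
def keyAt (i : ℕ) : List Bool := (kb.drop (i * S.P.eval n)).take (S.P.eval n)

/-- The basic index of key `i`: `1ⁿ 0 (key i)`. [folklore] -/
def idxAt (i : ℕ) : List Bool := ones n ++ false :: keyAt S n kb i

/-- A `2m`-bit block of a string. [folklore] -/
def blk (z : List Bool) (j : ℕ) : List Bool := (z.drop (j * (2 * S.m n))).take (2 * S.m n)

/-- **Blockwise hashing** (Construction 6.4.24): the basic function of index `1ⁿ0r` applied to each `2m`-bit block.
[cite: Goldreich2004, Construction 6.4.24] -/
def blockwise (r z : List Bool) : List Bool :=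
  ccat (fun j => S.hb (boolPair (ones n ++ false :: r) (blk S n z j))) (z.length / (2 * S.m n))

variable (x : List Bool)

/-- **The levels of the tree** (Construction 6.4.26): `z₀ = pad x`, `z_{i+1} = blockwise (key i) z_i`.
[cite: Goldreich2004, Construction 6.4.26] -/
noncomputable def level : ℕ → List Bool
  | 0 => padStr (S.m n) x
  | i + 1 => blockwise S n (keyAt S n kb i) (level i)

/-- The width of the depth field of the output: `|bin L| + 1`. [folklore] -/
def aL : ℕ := (encodeNat (S.L n)).length + 1

/-- The depth of `x` at level `n`. [folklore] -/
noncomputable def dep : ℕ := depth (S.m n) x.length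

/-- **The tree hash at level `n`**: `⟨depth⟩ ++ top level` (fixed length `aL + m`), junk (zeros) beyond depth `L`.
[cite: Goldreich2004, Construction 6.4.26 (the output `(t, h_{s_t}(⋯))`)] -/
noncomputable def treeOut : List Bool :=
  if dep S n x ≤ S.L n then fitLen (aL S n) (encodeNat (dep S n x)) ++ level S n kb x (dep S n x)
  else List.replicate (aL S n + S.m n) false

variable {S n kb x}

/-- `|key i| = P n` when the coins are long enough. [folklore] -/
theorem length_keyAt (hkb : S.L n * S.P.eval n ≤ kb.length) {i : ℕ} (hi : i < S.L n) : (keyAt S n kb i).length = S.P.eval n := by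
  rw [keyAt, List.length_take, List.length_drop, min_eq_left]
  have : (i + 1) * S.P.eval n ≤ kb.length := le_trans (Nat.mul_le_mul_right _ (Nat.succ_le_of_lt hi)) hkb
  rw [Nat.succ_mul] at this; omega

/-- **Length of a blockwise hash**: `k` blocks of `2m` bits give `k·m` bits. [cite: Goldreich2004, Construction 6.4.24 (`|h'_s(x)|`)] -/
theorem length_blockwise (hS : S.WF) {r : List Bool} (hr : r.length = S.P.eval n) {z : List Bool} {k : ℕ} (hz : z.length = k * (2 * S.m n)) :
    (blockwise S n r z).length = k * S.m n := by
  have hm := hS.one_le_m n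
  have hk : z.length / (2 * S.m n) = k := by rw [hz, Nat.mul_div_cancel _ (by omega)]
  rw [blockwise, hk]
  exact length_ccat_blocks fun i hi => hS.length_hb n r _ hr (by
    rw [blk, List.length_take, List.length_drop, hz, min_eq_left]
    have := Nat.mul_le_mul_right (2 * S.m n) (Nat.succ_le_of_lt hi); rw [Nat.succ_mul] at this; omega)

/-- **Length of the levels**: `|z_i| = m·2^{t−i}` for `i ≤ t = depth`. [cite: Goldreich2004, Construction 6.4.26] -/
theorem length_level (hS : S.WF) (hkb : S.L n * S.P.eval n ≤ kb.length) (ht : dep S n x ≤ S.L n) :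
    ∀ {i : ℕ}, i ≤ dep S n x → (level S n kb x i).length = S.m n * 2 ^ (dep S n x - i)
  | 0, _ => by rw [level, length_padStr (hS.one_le_m n), Nat.sub_zero]; rfl
  | i + 1, hi => by
    rw [level, length_blockwise hS (length_keyAt hkb (by omega)) (k := 2 ^ (dep S n x - (i + 1)))
      (by rw [length_level hS hkb ht (Nat.le_of_succ_le hi), show dep S n x - i = dep S n x - (i + 1) + 1 by omega, pow_succ]; ring)]
    ring

/-- The top level has `m` bits. [folklore] -/
theorem length_level_dep (hS : S.WF) (hkb : S.L n * S.P.eval n ≤ kb.length) (ht : dep S n x ≤ S.L n) :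
    (level S n kb x (dep S n x)).length = S.m n := by
  rw [length_level hS hkb ht le_rfl, Nat.sub_self, pow_zero, mul_one]

/-- **Range**: the tree hash has `aL + m` bits on every input. [cite: Goldreich2004, Construction 6.4.26 (`h' : {0,1}* → {0,1}^{n + log n}`)] -/
theorem length_treeOut (hS : S.WF) (hkb : S.L n * S.P.eval n ≤ kb.length) : (treeOut S n kb x).length = aL S n + S.m n := by
  unfold treeOut
  split_ifs with h
  · rw [List.length_append, length_fitLen, length_level_dep hS hkb h]
  · rw [List.length_replicate]

/-- A depth within range fits in the depth field: `|bin t| < aL` for `t ≤ L`. [folklore] -/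
theorem length_encodeNat_lt_aL {t : ℕ} (ht : t ≤ S.L n) : (encodeNat t).length < aL S n := by
  rw [aL, Nat.lt_succ_iff]
  by_contra h
  push Not at h
  -- `2^{|bin L|} ≤ 2^{|bin t| - 1} ≤ t ≤ L < 2^{|bin L|}`
  have h1 : 2 ^ (encodeNat t).length ≤ 2 * t + 1 := UExpr.pow2_le (fun _ => t) (UExpr.var 0)
  have h2 : S.L n < 2 ^ (encodeNat (S.L n)).length := by simpa using bitsToNat_lt (encodeNat (S.L n))
  have h3 : 2 ^ ((encodeNat (S.L n)).length + 1) ≤ 2 ^ (encodeNat t).length := Nat.pow_le_pow_right (by norm_num) h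
  rw [pow_succ] at h3
  omega

/-- The depth field of a tree hash within range decodes to the depth. [folklore] -/
theorem bitsToNat_take_treeOut (ht : dep S n x ≤ S.L n) : bitsToNat ((treeOut S n kb x).take (aL S n)) = dep S n x := by
  rw [treeOut, if_pos ht, List.take_append_of_le_length (by rw [length_fitLen]), List.take_of_length_le (by rw [length_fitLen]),
    fitLen, List.take_of_length_le (length_encodeNat_lt_aL ht).le, bitsToNat_append, bitsToNat_replicate_false, mul_zero, add_zero,
    bitsToNat_encodeNat]

/-- The top-level field of a tree hash within range. [folklore] -/
theorem drop_treeOut (ht : dep S n x ≤ S.L n) : (treeOut S n kb x).drop (aL S n) = level S n kb x (dep S n x) := by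
  rw [treeOut, if_pos ht, List.drop_left' (length_fitLen _ _)]

/-- The padding contains a `true`, so the bottom level is never all-zero. [folklore] -/
theorem level_zero_ne_replicate (k : ℕ) : level S n kb x 0 ≠ List.replicate k false := by
  intro h
  have : true ∈ level S n kb x 0 := by rw [level, padStr]; simp
  rw [h] at this
  simp at this

/-- **Equal tree hashes of an in-range input and any other input**: the other input is in range too, the depths
agree and the top levels agree. [cite: Goldreich2004, Construction 6.4.26 ("Observe that … implies that both equal the pair")] -/
theorem treeOut_eq_treeOut {x x' : List Bool} (hx : dep S n x ≤ S.L n)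
    (h : treeOut S n kb x = treeOut S n kb x') :
    dep S n x' ≤ S.L n ∧ dep S n x = dep S n x' ∧ level S n kb x (dep S n x) = level S n kb x' (dep S n x') := by
  have hx' : dep S n x' ≤ S.L n := by
    by_contra hc
    have hj : treeOut S n kb x' = List.replicate (aL S n + S.m n) false := by rw [treeOut, if_neg hc]
    -- then the depth field of `x` is zero, so `x` has depth `0`, and its bottom level would be all-zero
    have hd : dep S n x = 0 := by
      have := bitsToNat_take_treeOut (kb := kb) hx
      rw [h, hj, List.take_replicate, bitsToNat_replicate_false] at this
      exact this.symm
    have hl := drop_treeOut (kb := kb) hx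
    rw [h, hj, List.drop_replicate, hd] at hl
    exact level_zero_ne_replicate _ hl.symm
  have hdep : dep S n x = dep S n x' := by
    rw [← bitsToNat_take_treeOut (kb := kb) hx, ← bitsToNat_take_treeOut (kb := kb) hx', h]
  refine ⟨hx', hdep, ?_⟩
  rw [← drop_treeOut (kb := kb) hx, ← drop_treeOut (kb := kb) hx', h]

end Tree

/-! ### Localising a collision -/

section Localise

variable {S : TSpec} {n : ℕ} {kb : List Bool}

/-- **A blockwise collision is a collision at some block.** [cite: Goldreich2004, Prop. 6.4.25 ("there exists an `i` such that
`x_i ≠ x'_i` and `h_s(x_i) = h_s(x'_i)`")] -/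
theorem exists_block_collision (hS : S.WF) {r : List Bool} (hr : r.length = S.P.eval n) {z z' : List Bool} {k : ℕ}
    (hz : z.length = k * (2 * S.m n)) (hz' : z'.length = k * (2 * S.m n)) (hne : z ≠ z') (heq : blockwise S n r z = blockwise S n r z') :
    ∃ j, j < k ∧ blk S n z j ≠ blk S n z' j ∧
      S.hb (boolPair (ones n ++ false :: r) (blk S n z j)) = S.hb (boolPair (ones n ++ false :: r) (blk S n z' j)) := by
  have hm := hS.one_le_m n
  have hk : ∀ {w : List Bool}, w.length = k * (2 * S.m n) → w.length / (2 * S.m n) = k := fun hw => by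
    rw [hw, Nat.mul_div_cancel _ (by omega)]
  have hblk : ∀ {w : List Bool}, w.length = k * (2 * S.m n) → ∀ i, i < k → (blk S n w i).length = 2 * S.m n := fun hw i hi => by
    rw [blk, List.length_take, List.length_drop, hw, min_eq_left]
    have := Nat.mul_le_mul_right (2 * S.m n) (Nat.succ_le_of_lt hi); rw [Nat.succ_mul] at this; omega
  have hpiece : ∀ {w : List Bool}, w.length = k * (2 * S.m n) → ∀ i, i < k →
      (S.hb (boolPair (ones n ++ false :: r) (blk S n w i))).length = S.m n := fun hw i hi => hS.length_hb n r _ hr (hblk hw i hi)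
  rw [blockwise, blockwise, hk hz, hk hz'] at heq
  by_contra hc
  push Not at hc
  -- every block pair that differs hashes differently; but the pieces all agree, so every block agrees
  have hall : ∀ j, j < k → blk S n z j = blk S n z' j := by
    intro j hj
    by_contra hb
    have e1 := ccat_block (hpiece hz) hj
    have e2 := ccat_block (hpiece hz') hj
    rw [heq] at e1
    exact hc j hj hb (e1.symm.trans e2)
  apply hne
  rw [← ccat_of_blocks hz, ← ccat_of_blocks hz']
  exact ccat_congr fun i hi => hall i hi

/-- **Localising a designated collision of the tree**: for `x ≠ x'` in range with equal tree hashes there are a level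
`i < t` and a block `j < 2^{t−i−1}` such that the level-`i` strings differ at block `j` but the key-`i` function merges the
two blocks. [cite: Goldreich2004, proofs of Props. 6.4.25 and 6.4.27] -/
theorem exists_level_block_collision (hS : S.WF) (hkb : S.L n * S.P.eval n ≤ kb.length) {x x' : List Bool} (hx : dep S n x ≤ S.L n)
    (hne : x ≠ x') (h : treeOut S n kb x = treeOut S n kb x') :
    ∃ i, i < dep S n x ∧ ∃ j, j < 2 ^ (dep S n x - (i + 1)) ∧
      blk S n (level S n kb x i) j ≠ blk S n (level S n kb x' i) j ∧
      S.hb (boolPair (idxAt S n kb i) (blk S n (level S n kb x i) j)) = S.hb (boolPair (idxAt S n kb i) (blk S n (level S n kb x' i) j)) := by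
  obtain ⟨hx', hdep, htop⟩ := treeOut_eq_treeOut hx h
  -- the first level at which the two sequences agree
  have h0 : level S n kb x 0 ≠ level S n kb x' 0 := by
    rw [level, level]; intro hp; exact hne (padStr_injective _ (by
      have := congrArg List.length hp
      rw [length_padStr (hS.one_le_m n), length_padStr (hS.one_le_m n)] at this
      -- equal padded lengths and equal paddings
      exact hp))
  classical
  have htop' := htop
  rw [← hdep] at htop'
  have hex : ∃ i, level S n kb x (i + 1) = level S n kb x' (i + 1) ∧ i < dep S n x := by
    rcases Nat.eq_zero_or_pos (dep S n x) with hd | hd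
    · exfalso; rw [hd] at htop'; exact h0 htop'
    · exact ⟨dep S n x - 1, by rw [Nat.sub_add_cancel hd]; exact htop', by omega⟩
  let i := Nat.find hex
  have hi : level S n kb x (i + 1) = level S n kb x' (i + 1) ∧ i < dep S n x := Nat.find_spec hex
  have hprev : level S n kb x i ≠ level S n kb x' i := by
    rcases Nat.eq_zero_or_pos i with hi0 | hi0
    · rw [hi0]; exact h0
    · intro heq
      have := Nat.find_min hex (m := i - 1) (by omega)
      exact this ⟨by rw [Nat.sub_add_cancel hi0]; exact heq, by omega⟩
  refine ⟨i, hi.2, ?_⟩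
  have hlen := length_level hS hkb hx hi.2.le
  have hlen' : (level S n kb x' i).length = 2 ^ (dep S n x - (i + 1)) * (2 * S.m n) := by
    rw [length_level hS hkb hx' (by omega), ← hdep, show dep S n x - i = dep S n x - (i + 1) + 1 by omega, pow_succ]; ring
  rw [show S.m n * 2 ^ (dep S n x - i) = 2 ^ (dep S n x - (i + 1)) * (2 * S.m n) by
    rw [show dep S n x - i = dep S n x - (i + 1) + 1 by omega, pow_succ]; ring] at hlen
  have heq : blockwise S n (keyAt S n kb i) (level S n kb x i) = blockwise S n (keyAt S n kb i) (level S n kb x' i) := by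
    have := hi.1; rwa [level, level] at this
  obtain ⟨j, hj, hb, hc⟩ := exists_block_collision hS (length_keyAt hkb (lt_of_lt_of_le hi.2 hx)) hlen hlen' hprev heq
  exact ⟨j, hj, hb, hc⟩

end Localise

end TreeHash

end Literature.Computability.Cryptography
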